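import Summits.NavierStokesRegularity.NavierStokesRegularity.Theorems.TypeIIInviscidRelaxationAxisymSwirlRegularBarrierWall
import Summits.NavierStokesRegularity.NavierStokesRegularity.Theorems.ScenarioCensusRowF5lgBarrier
import Mathlib.MeasureTheory.Integral.IntervalIntegral.FundThmCalculus
import HarnessLib

/-!
# Feller's test for tube barriers, and the exact reach of the log gate: `c > 1`

Helper toward the crux `AxisymSwirlRegular` (stmt-NavierStokesRegularity-1964, route TypeIIInviscidRelaxation),
criterion side of the registered line `radial_inflow_split` (stub `stub_oneSidedRadialCriterion`, ⟨19059⟩): which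
ONE-SIDED inflow envelopes `u_r ≥ −E(r)` between the proved constant gate `E = C/r`, `C < 2`
(`ScenarioCensus.LogGate.oneSidedRadialCriterion_of_lt_two`) and the open one `C ≥ 2` are reachable by the landed
comparison engine `ScenarioCensus.LogGate.tubeComparison_holds`, whose only analytic input is a tube barrier
`ScenarioCensus.LogGate.IsTubeBarrier δ₀ E w`?

* `entrance_noBarrier_of_scale` — **Feller's test (divergent side), general envelope.** If `ψ > 0` integrates the
  drift, `ψ′ = (E − 1/r)ψ` on `(0,a)`, and the scale integral `∫_r^{r₀} dt/ψ(t)` is unbounded as `r → 0⁺`, then no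
  positive `C²` function with `φ″ − φ′/r + Eφ′ ≤ 0` on `(0,a)` tends to `0` at `0⁺`.  (Proof: `ψφ′` is
  non-increasing, so below a point of positive slope `φ′ ≥ c₀/ψ` and `φ(r₀) − φ(r) ≥ c₀∫_r^{r₀}dt/ψ → ∞`,
  contradicting `φ > 0`.)  `RadialInflowBarrierWall.entrance_noBarrier` is the case `E = M/r`, `ψ = r^{M−1}`.
* `not_isTubeBarrier_logGate_one` / `not_isTubeBarrier_logGate_of_le_one` — for the log-gate envelope
  `E_c(r) = (2 − c/log(1/r))/r` of census row F5lg (`ScenarioCensus.LogGate.logInflowEnvelope c 1`) with `c ≤ 1`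
  there is NO tube barrier on any tube `δ₀ < 1` (`ψ = r log(1/r)`, scale integral `log log(1/r) → ∞`; `c < 1`
  reduces to `c = 1` because `E_c ≥ E_1` and `w′ ≥ 0`).
* `exists_isTubeBarrier_logGate_iff` — with the tree's log barrier (`ScenarioCensus.LogGate.logBarrier_isTubeBarrier`,
  every `c > 1` via `β = c − 1`) the DICHOTOMY: a tube barrier for `E_c` exists on some tube `δ₀ ∈ (0,1)` iff `1 < c`.

Reading for the line: on the barrier side the log gate is SHARP at `c > 1` (the tree's criterion
`logGateCriterion_of` asks `c > 5/2` only because Wei's log-modulus regularity theorem needs the exponent `3/2`);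
together with `RadialInflowBarrierWall.exists_isTubeBarrier_iff_lt_two` (constant gates: iff `C < 2`),
`RadialInflowBarrierWallT.not_exists_halfLineBarrier_of_two_le` (time-dependent class, `C ≥ 2`) and
`RadialInflowCriticalSink.not_uniform_modulus` (exact linear witnesses at `C = 2`) this maps the reach of the
comparison method among one-sided gates: exactly the envelopes whose Bessel scale integral converges at the axis.
Method-tightness only; nothing here bears on the truth of the stub, and nothing here proves `AxisymSwirlRegular` or
NavierStokesRegularity.

References: W. Feller, Ann. of Math. 55 (1952), §§1–2 (scale function; accessible vs. entrance boundary);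
Q. S. Zhang, arXiv:2604.07785 (2026), §3 [Zhang2026PartialTypeI]. [folklore]
-/

noncomputable section

set_option linter.dupNamespace false

open Set Filter Topology
open Literature.Analysis.FluidPDE

namespace Summit.NavierStokesRegularity.NavierStokesRegularity.Theorems.RadialInflowBarrierWallLog

open Summit.NavierStokesRegularity.NavierStokesRegularity.Theorems.ScenarioCensus.LogGate
open Summit.NavierStokesRegularity.NavierStokesRegularity.Theorems.RadialInflowBarrierWall

/-! ## §1 Feller's test: no barrier when the scale integral diverges -/

/-- **Feller's test for tube barriers (divergent side).** Let `E` be an inflow envelope on `(0,a)` and `ψ > 0` an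
integrating factor of the drift, `ψ′ = (E − 1/r)ψ`.  If the scale integral `∫_r^{r₀} dt/ψ(t)` is unbounded as
`r → 0⁺` (for every `0 < r₀ < a`), then no positive function `φ`, twice differentiable on `(0,a)` with
`φ″ − φ′/r + E φ′ ≤ 0`, tends to `0` at `0⁺`.  Proof: a point `r₀` of positive slope exists (else `φ` is antitone
and cannot tend to `0`); `(ψφ′)′ = ψ(φ″ + (E − 1/r)φ′) ≤ 0`, so `φ′ ≥ c₀/ψ` on `(0,r₀]` with `c₀ = ψ(r₀)φ′(r₀) > 0`,
and `φ(r₀) − φ(r) = ∫_r^{r₀} φ′ ≥ c₀ ∫_r^{r₀} dt/ψ` is unbounded, contradicting `φ > 0`. [folklore: Feller 1952] -/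
theorem entrance_noBarrier_of_scale {a : ℝ} (ha : 0 < a) {E ψ φ φ' φ'' : ℝ → ℝ}
    (hφ : ∀ r ∈ Ioo 0 a, HasDerivAt φ (φ' r) r) (hφ' : ∀ r ∈ Ioo 0 a, HasDerivAt φ' (φ'' r) r)
    (hpos : ∀ r ∈ Ioo 0 a, 0 < φ r)
    (hsup : ∀ r ∈ Ioo 0 a, φ'' r - r⁻¹ * φ' r + E r * φ' r ≤ 0)
    (hψ : ∀ r ∈ Ioo 0 a, HasDerivAt ψ ((E r - r⁻¹) * ψ r) r) (hψpos : ∀ r ∈ Ioo 0 a, 0 < ψ r)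
    (hdiv : ∀ r₀ ∈ Ioo 0 a, ∀ K : ℝ, ∃ r ∈ Ioo 0 r₀, K ≤ ∫ t in r..r₀, (ψ t)⁻¹) :
    ¬ Tendsto φ (𝓝[>] 0) (𝓝 0) := by
  intro hlim
  have hdiff : DifferentiableOn ℝ φ (Ioo 0 a) := fun r hr =>
    (hφ r hr).differentiableAt.differentiableWithinAt
  have hderiv : ∀ r ∈ Ioo 0 a, deriv φ r = φ' r := fun r hr => (hφ r hr).deriv
  -- Step 1: a point with positive slope (else `φ` is antitone and cannot tend to `0` at `0⁺`).
  obtain ⟨r₀, hr₀, hφ'pos⟩ : ∃ r₀ ∈ Ioo 0 a, 0 < φ' r₀ := by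
    by_contra hneg
    push Not at hneg
    have hanti : AntitoneOn φ (Ioo 0 a) :=
      antitoneOn_of_deriv_nonpos (convex_Ioo 0 a) hdiff.continuousOn (by rwa [interior_Ioo])
        (by
          intro r hr
          rw [interior_Ioo] at hr
          rw [hderiv r hr]
          exact hneg r hr)
    have h12 : a / 2 ∈ Ioo 0 a := ⟨by positivity, by linarith⟩
    have hc : 0 < φ (a / 2) := hpos _ h12
    have hev : ∀ᶠ r in 𝓝[>] (0 : ℝ), φ r < φ (a / 2) / 2 := hlim (Iio_mem_nhds (by positivity))
    obtain ⟨δ, hδ, hsub⟩ := mem_nhdsGT_iff_exists_Ioo_subset.mp hev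
    have hδ' : (0 : ℝ) < δ := hδ
    have hr0 : 0 < min (δ / 2) (a / 4) := lt_min (by linarith) (by positivity)
    have hrδ : min (δ / 2) (a / 4) < δ := by
      have := min_le_left (δ / 2) (a / 4); linarith
    have hr12 : min (δ / 2) (a / 4) ≤ a / 2 := by
      have := min_le_right (δ / 2) (a / 4); linarith
    have h1 : φ (min (δ / 2) (a / 4)) < φ (a / 2) / 2 := hsub ⟨hr0, hrδ⟩
    have h2 : φ (a / 2) ≤ φ (min (δ / 2) (a / 4)) := hanti ⟨hr0, by linarith⟩ h12 hr12
    linarith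
  -- Step 2: `g = ψ φ'` is antitone on `(0, a)`.
  set c₀ := ψ r₀ * φ' r₀ with hc₀_def
  have hc₀ : 0 < c₀ := mul_pos (hψpos r₀ hr₀) hφ'pos
  have hg : ∀ r ∈ Ioo 0 a, HasDerivAt (fun s => ψ s * φ' s)
      ((E r - r⁻¹) * ψ r * φ' r + ψ r * φ'' r) r := fun r hr => (hψ r hr).mul (hφ' r hr)
  have hg_nonpos : ∀ r ∈ Ioo 0 a, (E r - r⁻¹) * ψ r * φ' r + ψ r * φ'' r ≤ 0 := by
    intro r hr
    have heq : (E r - r⁻¹) * ψ r * φ' r + ψ r * φ'' r = ψ r * (φ'' r - r⁻¹ * φ' r + E r * φ' r) := by ring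
    rw [heq]
    exact mul_nonpos_iff.mpr (Or.inl ⟨(hψpos r hr).le, hsup r hr⟩)
  have hg_anti : AntitoneOn (fun s => ψ s * φ' s) (Ioo 0 a) := by
    apply antitoneOn_of_deriv_nonpos (convex_Ioo 0 a)
    · exact fun r hr => (hg r hr).continuousAt.continuousWithinAt
    · rw [interior_Ioo]; exact fun r hr => (hg r hr).differentiableAt.differentiableWithinAt
    · rw [interior_Ioo]; intro r hr; rw [(hg r hr).deriv]; exact hg_nonpos r hr
  -- Step 3: `φ' ≥ c₀/ψ` on `(0, r₀]`.
  have hφ'_lb : ∀ r ∈ Ioo 0 a, r ≤ r₀ → c₀ * (ψ r)⁻¹ ≤ φ' r := by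
    intro r hr hrr
    have h1 : c₀ ≤ ψ r * φ' r := hg_anti hr hr₀ hrr
    have hψr := hψpos r hr
    rw [← div_eq_mul_inv, div_le_iff₀ hψr]
    linarith
  -- Step 4: `φ(r₀) − φ(r) ≥ c₀ ∫_r^{r₀} dt/ψ` for `0 < r < r₀`.
  have hint : ∀ r ∈ Ioo 0 r₀, c₀ * ∫ t in r..r₀, (ψ t)⁻¹ ≤ φ r₀ - φ r := by
    intro r hr
    have hsubI : Icc r r₀ ⊆ Ioo 0 a := fun t ht => ⟨hr.1.trans_le ht.1, ht.2.trans_lt hr₀.2⟩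
    have hle : r ≤ r₀ := hr.2.le
    -- continuity of `φ'` and `ψ⁻¹` on `[r, r₀]`
    have hφ'c : ContinuousOn φ' (Icc r r₀) := fun t ht => (hφ' t (hsubI ht)).continuousAt.continuousWithinAt
    have hψc : ContinuousOn (fun t => (ψ t)⁻¹) (Icc r r₀) := fun t ht =>
      ((hψ t (hsubI ht)).continuousAt.inv₀ (hψpos t (hsubI ht)).ne').continuousWithinAt
    have hFTC : ∫ t in r..r₀, φ' t = φ r₀ - φ r := by
      refine intervalIntegral.integral_eq_sub_of_hasDerivAt (fun t ht => hφ t (hsubI ?_))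
        (hφ'c.intervalIntegrable_of_Icc hle)
      rwa [uIcc_of_le hle] at ht
    have hmono : ∫ t in r..r₀, c₀ * (ψ t)⁻¹ ≤ ∫ t in r..r₀, φ' t :=
      intervalIntegral.integral_mono_on hle ((hψc.intervalIntegrable_of_Icc hle).const_mul c₀)
        (hφ'c.intervalIntegrable_of_Icc hle) fun t ht => hφ'_lb t (hsubI ht) ht.2
    rw [intervalIntegral.integral_const_mul] at hmono
    linarith
  -- Step 5: the scale integral is unbounded, `φ` would be negative somewhere.
  obtain ⟨r, hr, hK⟩ := hdiv r₀ hr₀ ((φ r₀ + 1) / c₀)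
  have h1 := hint r hr
  have h2 : φ r₀ + 1 ≤ c₀ * ∫ t in r..r₀, (ψ t)⁻¹ := by
    rw [div_le_iff₀ hc₀] at hK
    linarith
  have h3 := hpos r ⟨hr.1, hr.2.trans hr₀.2⟩
  linarith

/-! ## §2 The log gate: no tube barrier for `c ≤ 1` -/

/-- The scale integral of the log gate at `c = 1`: for `0 < r ≤ r₀ < 1`,
`∫_r^{r₀} dt/(t log(1/t)) = log log(1/r) − log log(1/r₀)`. [folklore] -/
theorem integral_inv_mul_negLog {r r₀ : ℝ} (hr : 0 < r) (hrr : r ≤ r₀) (hr₀ : r₀ < 1) :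
    ∫ t in r..r₀, (t * (-Real.log t))⁻¹ = Real.log (-Real.log r) - Real.log (-Real.log r₀) := by
  have hsubI : Icc r r₀ ⊆ Ioo 0 1 := fun t ht => ⟨hr.trans_le ht.1, ht.2.trans_lt hr₀⟩
  -- antiderivative `t ↦ -log(-log t)`
  have hF : ∀ t ∈ Ioo (0 : ℝ) 1, HasDerivAt (fun s => -Real.log (-Real.log s)) ((t * (-Real.log t))⁻¹) t := by
    intro t ht
    have hL : 0 < -Real.log t := neg_log_pos ht.1 ht.2
    have h1 : HasDerivAt (fun s => -Real.log s) (-(t⁻¹)) t := (Real.hasDerivAt_log ht.1.ne').neg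
    have h2 := (h1.log hL.ne').neg
    refine h2.congr_deriv ?_
    field_simp
  have hcont : ContinuousOn (fun t : ℝ => (t * (-Real.log t))⁻¹) (Icc r r₀) := by
    intro t ht
    have ht' := hsubI ht
    have hL : 0 < -Real.log t := neg_log_pos ht'.1 ht'.2
    have hne : t * (-Real.log t) ≠ 0 := (mul_pos ht'.1 hL).ne'
    have hc : ContinuousAt (fun s : ℝ => s * (-Real.log s)) t :=
      continuousAt_id.mul (Real.continuousAt_log ht'.1.ne').neg
    exact (hc.inv₀ hne).continuousWithinAt
  have h := intervalIntegral.integral_eq_sub_of_hasDerivAt (a := r) (b := r₀)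
    (f := fun s => -Real.log (-Real.log s)) (f' := fun t => (t * (-Real.log t))⁻¹)
    (fun t ht => hF t (hsubI (by rwa [uIcc_of_le hrr] at ht))) (hcont.intervalIntegrable_of_Icc hrr)
  rw [h]
  ring

/-- **No tube barrier for the log gate at `c = 1`.** For `E_1(r) = (2 − 1/log(1/r))/r`
(`logInflowEnvelope 1 1`) and every tube `0 < δ₀ < 1`: `¬ IsTubeBarrier δ₀ E_1 w`.  Feller's test with
`ψ(r) = r log(1/r)` (`ψ′ = log(1/r) − 1 = (E_1 − 1/r)ψ`) and the divergent scale integral `log log(1/r)`.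
[folklore] -/
theorem not_isTubeBarrier_logGate_one {δ₀ : ℝ} (hδ : 0 < δ₀) (hδ1 : δ₀ < 1) (w : ℝ → ℝ) :
    ¬ IsTubeBarrier δ₀ (logInflowEnvelope 1 1) w := by
  intro hw
  have hpos : ∀ r ∈ Ioo 0 δ₀, 0 < w r := fun r hr => isTubeBarrier_pos_of_pos hw hr.1 hr.2.le
  have hlim := isTubeBarrier_tendsto_zero hw hδ
  obtain ⟨hC2, -, -, -, -, -, hsup⟩ := hw
  refine entrance_noBarrier_of_scale (E := logInflowEnvelope 1 1) (ψ := fun r => r * (-Real.log r)) (φ := w)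
    (φ' := deriv w) (φ'' := iteratedDeriv 2 w) hδ
    (fun r hr => (SliceCalc.slice_derivs hC2 hr).1) (fun r hr => (SliceCalc.slice_derivs hC2 hr).2) hpos
    hsup (fun r hr => ?_) (fun r hr => mul_pos hr.1 (neg_log_pos hr.1 (hr.2.trans hδ1))) (fun r₀ hr₀ K => ?_) hlim
  · -- `ψ′ = (E_1 − 1/r) ψ`
    have hr0 : r ≠ 0 := hr.1.ne'
    have hL : Real.log r ≠ 0 := (Real.log_neg hr.1 (hr.2.trans hδ1)).ne
    have h1 : HasDerivAt (fun s : ℝ => s * (-Real.log s)) (1 * (-Real.log r) + r * (-(r⁻¹))) r :=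
      (hasDerivAt_id r).mul (Real.hasDerivAt_log hr0).neg
    refine h1.congr_deriv ?_
    simp only [logInflowEnvelope]
    field_simp
    ring
  · -- divergence of the scale integral: choose `r ≤ exp(−(−log r₀)·exp K)`
    have hr₀1 : r₀ < 1 := hr₀.2.trans hδ1
    have hL₀ : 0 < -Real.log r₀ := neg_log_pos hr₀.1 hr₀1
    set r : ℝ := min (r₀ / 2) (Real.exp (-((-Real.log r₀) * Real.exp K))) with hr_def
    have hr0 : 0 < r := lt_min (by linarith [hr₀.1]) (Real.exp_pos _)
    have hrr₀ : r < r₀ := (min_le_left _ _).trans_lt (by linarith [hr₀.1])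
    refine ⟨r, ⟨hr0, hrr₀⟩, ?_⟩
    rw [integral_inv_mul_negLog hr0 hrr₀.le hr₀1]
    -- `-log r ≥ (-log r₀) e^K`, so `log(-log r) ≥ log(-log r₀) + K`
    have h1 : (-Real.log r₀) * Real.exp K ≤ -Real.log r := by
      have h2 : r ≤ Real.exp (-((-Real.log r₀) * Real.exp K)) := min_le_right _ _
      have h3 := Real.log_le_log hr0 h2
      rw [Real.log_exp] at h3
      linarith
    have h4 : Real.log ((-Real.log r₀) * Real.exp K) ≤ Real.log (-Real.log r) :=
      Real.log_le_log (mul_pos hL₀ (Real.exp_pos K)) h1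
    rw [Real.log_mul hL₀.ne' (Real.exp_pos K).ne', Real.log_exp] at h4
    linarith

/-- **No tube barrier for the log gate with `c ≤ 1`.** `E_c ≥ E_1` for `c ≤ 1` (as `log(1/r) > 0` on the tube), so
a tube barrier for `E_c` (with `w′ ≥ 0`) would be one for `E_1`. [folklore] -/
theorem not_isTubeBarrier_logGate_of_le_one {c δ₀ : ℝ} (hc : c ≤ 1) (hδ : 0 < δ₀) (hδ1 : δ₀ < 1)
    (w : ℝ → ℝ) : ¬ IsTubeBarrier δ₀ (logInflowEnvelope c 1) w := by
  intro hw
  obtain ⟨hC2, hC0, h0, hδpos, hK, hmono, hsup⟩ := hw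
  refine not_isTubeBarrier_logGate_one hδ hδ1 w ⟨hC2, hC0, h0, hδpos, hK, hmono, fun r hr => ?_⟩
  have hL : 0 < -Real.log r := neg_log_pos hr.1 (hr.2.trans hδ1)
  have hE : logInflowEnvelope 1 1 r ≤ logInflowEnvelope c 1 r := by
    simp only [logInflowEnvelope, one_mul]
    have h1 : c / (-Real.log r) ≤ 1 / (-Real.log r) := div_le_div_of_nonneg_right hc hL.le
    exact div_le_div_of_nonneg_right (by linarith) hr.1.le
  have h := hsup r hr
  have hd := hmono r hr
  nlinarith [mul_le_mul_of_nonneg_right hE hd]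

/-- **The log gate's barrier class: the dichotomy at `c = 1`.** A tube barrier for the log-gate envelope
`E_c = (2 − c/log(1/r))/r` exists on some tube `δ₀ ∈ (0,1)` iff `1 < c`: for `c > 1` the tree's log barrier
`(−log r)^{−(c−1)}` (`logBarrier_isTubeBarrier` with `β = c − 1`), for `c ≤ 1` Feller's test
(`not_isTubeBarrier_logGate_of_le_one`).  The log-gate analogue of
`RadialInflowBarrierWall.exists_isTubeBarrier_iff_lt_two`. [folklore] -/
theorem exists_isTubeBarrier_logGate_iff (c : ℝ) :
    (∃ δ₀ : ℝ, 0 < δ₀ ∧ δ₀ < 1 ∧ ∃ w : ℝ → ℝ, IsTubeBarrier δ₀ (logInflowEnvelope c 1) w) ↔ 1 < c := by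
  constructor
  · rintro ⟨δ₀, hδ, hδ1, w, hw⟩
    by_contra hc
    exact not_isTubeBarrier_logGate_of_le_one (not_lt.1 hc) hδ hδ1 w hw
  · intro hc
    exact ⟨1 / 2, by norm_num, by norm_num, _,
      logBarrier_isTubeBarrier (β := c - 1) (by linarith) (by linarith) (by norm_num) (by norm_num)⟩

end Summit.NavierStokesRegularity.NavierStokesRegularity.Theorems.RadialInflowBarrierWallLog

end
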